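/-
Copyright (c) 2026. All rights reserved.
Released under Apache 2.0 license as described in the file LICENSE.
-/
import Mathlib
import HarnessLib
import Summits.RiemannHypothesis.RiemannHypothesis.Theses.EarlyAppointments

/-!
# Helper lemmas for the G function in CombDescentStep

The function G(z) = g'(z)/g(z) where g = dslope f z₀ equals f'(z)/f(z) - 1/(z - z₀) for z ≠ z₀
and is analytic at z₀ when z₀ is a simple zero of f.

These lemmas support stmt-RiemannHypothesis-3184 (CombDescentStep).
-/

open Complex Real Set Filter Topology
open scoped BigOperators Topology

noncomputable section

namespace EarlyAppointmentsCombGHelpers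

/-- The main point: x₀ + ih as a complex number. -/
def z₀ (x₀ h : ℝ) : ℂ := (x₀ : ℂ) + h * I

/-- The function G(z) = g'(z)/g(z) where g = dslope f z₀, which equals f'(z)/f(z) - 1/(z - z₀)
    for z ≠ z₀ and is analytic at z₀ when z₀ is a simple zero. -/
def G (f : ℂ → ℂ) (z₀ : ℂ) (z : ℂ) : ℂ := deriv (dslope f z₀) z / dslope f z₀ z

/-- G is analytic at z₀ when z₀ is a simple zero of f.
The pole 1/(z - z₀) cancels with the pole of f'/f. -/
theorem G_analyticAt_of_simple_zero {f : ℂ → ℂ} {z₀ : ℂ}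
    (hf_diff : Differentiable ℂ f)
    (_hz₀ : f z₀ = 0)
    (hz₀_simple : deriv f z₀ ≠ 0) :
    AnalyticAt ℂ (G f z₀) z₀ := by
  -- G = g'/g where g = dslope f z₀, which is analytic at z₀ since g(z₀) = deriv f z₀ ≠ 0
  have hf_an : AnalyticAt ℂ f z₀ := Differentiable.analyticAt hf_diff z₀
  have hg_an : AnalyticAt ℂ (dslope f z₀) z₀ := by
    obtain ⟨p, hp⟩ := hf_an
    exact hp.has_fpower_series_dslope_fslope.analyticAt
  have hg_ne : dslope f z₀ z₀ ≠ 0 := by simp only [dslope_same]; exact hz₀_simple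
  -- G(z) = deriv(dslope f z₀) z / dslope f z₀ z is analytic at z₀
  unfold G
  exact hg_an.deriv.div hg_an hg_ne

/-- For z ≠ z₀ with f(z) ≠ 0, G(z) = f'(z)/f(z) - 1/(z - z₀). -/
theorem G_eq_logDeriv_sub {f : ℂ → ℂ} {z₀ z : ℂ}
    (hf_diff : Differentiable ℂ f)
    (hz₀ : f z₀ = 0)
    (hz : z ≠ z₀)
    (hfz : f z ≠ 0) :
    G f z₀ z = deriv f z / f z - 1 / (z - z₀) := by
  unfold G
  have hz_sub_ne : z - z₀ ≠ 0 := sub_ne_zero.mpr hz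
  have hf_factor' := sub_smul_dslope f z₀ z
  simp only [hz₀, sub_zero, smul_eq_mul] at hf_factor'
  have hf_factor : f z = (z - z₀) * dslope f z₀ z := hf_factor'.symm
  have hgz : dslope f z₀ z ≠ 0 := by
    intro h
    rw [hf_factor, h, mul_zero] at hfz
    exact hfz rfl
  -- Step 1: compute deriv f z using product rule
  have hg_diff : DifferentiableAt ℂ (dslope f z₀) z := by
    have hdOn : DifferentiableOn ℂ (dslope f z₀) Set.univ :=
      (Complex.differentiableOn_dslope (isOpen_univ.mem_nhds (Set.mem_univ z₀))).mpr
        hf_diff.differentiableOn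
    exact (hdOn z (Set.mem_univ z)).differentiableAt (isOpen_univ.mem_nhds (Set.mem_univ z))
  have hid_diff : DifferentiableAt ℂ (fun w => w - z₀) z := differentiableAt_id.sub (differentiableAt_const _)
  have hderiv_f : deriv f z = dslope f z₀ z + (z - z₀) * deriv (dslope f z₀) z := by
    have hfeq : ∀ w, f w = (w - z₀) * dslope f z₀ w := by
      intro w
      have := sub_smul_dslope f z₀ w
      simp only [hz₀, sub_zero, smul_eq_mul] at this
      exact this.symm
    have hderiv_eq : deriv f z = deriv (fun w => (w - z₀) * dslope f z₀ w) z := by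
      refine Filter.EventuallyEq.deriv_eq ?_
      filter_upwards with w using hfeq w
    rw [hderiv_eq, deriv_fun_mul hid_diff hg_diff]
    simp only [deriv_sub_const, deriv_id'', one_mul]
  -- Step 2: algebra to get deriv g z / g z = deriv f z / f z - 1/(z - z₀)
  rw [hf_factor, hderiv_f]
  field_simp [hz_sub_ne, hgz]
  ring

/-- The value of G at z₀: G(z₀) = g'(z₀)/g(z₀) where g = dslope f z₀. -/
theorem G_value_at_z₀ {f : ℂ → ℂ} {z₀ : ℂ}
    (_hf_diff : Differentiable ℂ f)
    (_hz₀ : f z₀ = 0)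
    (_hz₀_simple : deriv f z₀ ≠ 0) :
    G f z₀ z₀ = deriv (dslope f z₀) z₀ / dslope f z₀ z₀ := by
  unfold G
  rfl

/-- G(z₀) in terms of deriv f: G(z₀) = deriv (dslope f z₀) z₀ / deriv f z₀. -/
theorem G_value_at_z₀' {f : ℂ → ℂ} {z₀ : ℂ}
    (_hf_diff : Differentiable ℂ f)
    (_hz₀ : f z₀ = 0)
    (_hz₀_simple : deriv f z₀ ≠ 0) :
    G f z₀ z₀ = deriv (dslope f z₀) z₀ / deriv f z₀ := by
  unfold G
  simp only [dslope_same]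

end EarlyAppointmentsCombGHelpers

end
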